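import Summits.AnomalousDissipation.AnomalousDissipation.Theorems.SawtoothPulseCascadeK1LocalisedCascadeLedgerThinTarget
import Summits.AnomalousDissipation.AnomalousDissipation.Theorems.SawtoothPulseCascadeK1LocalisedCascadeDatumSpectrum

/-!
# Sketch — crux idea `lag-escape-renewal` (ad-ideate-p4 g2, lens `control`)
for `stmt-AnomalousDissipation-19491` = `…Theses.SawtoothPulseCascade.K1LocalisedCascade`.

CONTROLLING QUANTITY: not a budgeted functional but the LAG DISTRIBUTION of the inviscid iterates `a_n`,
  `F_n(u) = Σ'[K_n < |k₀| < u·c·rⁿ ∧ γ|k₁| ≤ 13/10·|k₀|] |𝓕a_n(k)|²`   (`r = γ² − 3`, box radius `K_n = N_n/(γθ)`),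
together with the steep channel `S_n` (all modes `13/10·|k₀| < γ|k₁|` above the box) and the frozen BOX `Z_n` (`|k₀| ≤ K_n`,
weak grating).  One cascade phase is TRANSPORT WITH DILATION by `g = (γ² − 23/10)/(γ² − 3) > 1` plus an ℓ¹ source
(`LagRenewal`: `√F_{n+1}(u) ≤ √F_n(u/g) + ε_n‖datum‖`, `Σ ε_n < ∞`; the size of `Σ ε_n` is IRRELEVANT).  The real-variable
`EscapeLemma` then gives `F_n(u) → 0` for every `u`; with `SteepTransient` (`S_n → 0`) and `BoxBound` (`Z_n ≤ ζ‖datum‖²`,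
`ζ < 1`) this yields, for EVERY `c > 0`, the S-D hypothesis `hch` of
`K1Ledger.From.k1Localised_of_thin_lowBand_offCone_frequently` (`EscapeTarget`, `EscapeAssembly`), hence
`K1Localised P (γ² − 3)` on the whole shape-P box INCLUDING `δ₀ = 1/4` (`k1Localised_of_escapeTarget`, PROVED below).
PROVED here (kernel-checked, standard axioms): `channels_indicator_le`, `escapeLemma : EscapeLemma`,
`escapeAssembly : EscapeAssembly`, `k1Localised_of_escapeTarget`, `k1Localised_of_escape_package` — i.e. everything except
the three cascade statements `LagRenewal`, `SteepTransient`, `BoxBound`, which are the line's conjectural inputs.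
-/

set_option linter.dupNamespace false

noncomputable section

namespace Summit.AnomalousDissipation.AnomalousDissipation.Cruxes.K1LocalisedCascade.LagEscape

open MeasureTheory Set Filter Topology UnitAddTorus Function
open Literature.Analysis Literature.Analysis.FunctionSpaces Literature.Analysis.FunctionSpaces.Torus Literature.Analysis.FluidPDE
open Literature.Analysis.FluidPDE.ShearStage
open Literature.Analysis.FluidPDE.SawtoothCascade Literature.Analysis.FluidPDE.SawtoothCascade.CascadeParams
open Summit.AnomalousDissipation.AnomalousDissipation.Theorems.SawtoothPulseCascade.K1Ledger.From

/-! ## §0 The three populations -/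

/-- BOX energy `Σ'[|k₀| ≤ K] |𝓕f(k)|²` (frozen population: horizontal frequencies for which the phase grating is weak). -/
def boxEnergy (K : ℝ) (f : UnitAddTorus (Fin 2) → ℝ) : ℝ :=
  ∑' k : Fin 2 → ℤ, (if |((k 0 : ℤ) : ℝ)| ≤ K then (1 : ℝ) else 0) * ‖mFourierCoeff (fun x => (f x : ℂ)) k‖ ^ 2

/-- ESCAPING population below `W`: on-cone energy (`γ|k₁| ≤ 13/10·|k₀|`) in the horizontal band `K < |k₀| < W`. -/
def coneBandEnergy (γ K W : ℝ) (f : UnitAddTorus (Fin 2) → ℝ) : ℝ :=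
  ∑' k : Fin 2 → ℤ, (if K < |((k 0 : ℤ) : ℝ)| ∧ |((k 0 : ℤ) : ℝ)| < W ∧ γ * |((k 1 : ℤ) : ℝ)| ≤ 13 / 10 * |((k 0 : ℤ) : ℝ)|
      then (1 : ℝ) else 0) * ‖mFourierCoeff (fun x => (f x : ℂ)) k‖ ^ 2

/-- STEEP population above the box: energy in `K < |k₀| ∧ 13/10·|k₀| < γ|k₁|` (threshold-free steep cone). -/
def steepEnergy (γ K : ℝ) (f : UnitAddTorus (Fin 2) → ℝ) : ℝ :=
  ∑' k : Fin 2 → ℤ, (if K < |((k 0 : ℤ) : ℝ)| ∧ 13 / 10 * |((k 0 : ℤ) : ℝ)| < γ * |((k 1 : ℤ) : ℝ)|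
      then (1 : ℝ) else 0) * ‖mFourierCoeff (fun x => (f x : ℂ)) k‖ ^ 2

/-- Box radius `K_n = N_n/(γθ)`: below it the phase grating `e^{2πi k₀ γ U_n}` has strength `≤ π/(2θ)` (weak). -/
def boxRadius (P : CascadeParams) (θ : ℝ) (n : ℕ) : ℝ := (P.N n : ℝ) / (P.γ * θ)

/-- PROVED (termwise channel domination): the two channels of the S-D target (`LowBand(W) + HighOffCone(W)`) are dominated
by `box(K) + escaping(K,W) + steep(K)` for ANY `K, W`. [folklore] -/
theorem channels_indicator_le (γ K W : ℝ) (kh kv : ℤ) :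
    (if |(kh : ℝ)| < W then (1 : ℝ) else 0) +
        (if W ≤ |(kh : ℝ)| ∧ 13 / 10 * |(kh : ℝ)| < γ * |(kv : ℝ)| then (1 : ℝ) else 0) ≤
      (if |(kh : ℝ)| ≤ K then (1 : ℝ) else 0) +
        (if K < |(kh : ℝ)| ∧ |(kh : ℝ)| < W ∧ γ * |(kv : ℝ)| ≤ 13 / 10 * |(kh : ℝ)| then (1 : ℝ) else 0) +
        (if K < |(kh : ℝ)| ∧ 13 / 10 * |(kh : ℝ)| < γ * |(kv : ℝ)| then (1 : ℝ) else 0) := by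
  have hI : ∀ (p : Prop) [Decidable p], (0 : ℝ) ≤ (if p then (1 : ℝ) else 0) ∧ (if p then (1 : ℝ) else 0) ≤ 1 :=
    fun p _ => by split_ifs <;> norm_num
  -- the left-hand side is at most one (its two indicators are exclusive)
  have hL : (if |(kh : ℝ)| < W then (1 : ℝ) else 0) +
      (if W ≤ |(kh : ℝ)| ∧ 13 / 10 * |(kh : ℝ)| < γ * |(kv : ℝ)| then (1 : ℝ) else 0) ≤ 1 := by
    by_cases hA : |(kh : ℝ)| < W
    · rw [if_pos hA, if_neg (fun h => (not_le.2 hA) h.1)]; norm_num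
    · rw [if_neg hA, zero_add]; exact (hI _).2
  rcases le_or_gt |(kh : ℝ)| K with hK | hK
  · -- inside the box: the right-hand side is ≥ 1
    rw [if_pos hK]
    linarith [(hI (K < |(kh : ℝ)| ∧ |(kh : ℝ)| < W ∧ γ * |(kv : ℝ)| ≤ 13 / 10 * |(kh : ℝ)|)).1,
      (hI (K < |(kh : ℝ)| ∧ 13 / 10 * |(kh : ℝ)| < γ * |(kv : ℝ)|)).1]
  · rw [if_neg (not_le.2 hK), zero_add]
    rcases lt_or_ge (13 / 10 * |(kh : ℝ)|) (γ * |(kv : ℝ)|) with hs | hs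
    · -- steep: the third indicator is one
      rw [if_pos (show K < |(kh : ℝ)| ∧ 13 / 10 * |(kh : ℝ)| < γ * |(kv : ℝ)| from ⟨hK, hs⟩)]
      linarith [(hI (K < |(kh : ℝ)| ∧ |(kh : ℝ)| < W ∧ γ * |(kv : ℝ)| ≤ 13 / 10 * |(kh : ℝ)|)).1]
    · -- on-cone: `HighOffCone` vanishes; `LowBand` is matched by the escaping indicator
      have hns : ¬ (13 / 10 * |(kh : ℝ)| < γ * |(kv : ℝ)|) := not_lt.2 hs
      rw [if_neg (show ¬ (K < |(kh : ℝ)| ∧ 13 / 10 * |(kh : ℝ)| < γ * |(kv : ℝ)|) from fun h => hns h.2), add_zero,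
        if_neg (show ¬ (W ≤ |(kh : ℝ)| ∧ 13 / 10 * |(kh : ℝ)| < γ * |(kv : ℝ)|) from fun h => hns h.2), add_zero]
      by_cases hW : |(kh : ℝ)| < W
      · rw [if_pos hW, if_pos (show K < |(kh : ℝ)| ∧ |(kh : ℝ)| < W ∧ γ * |(kv : ℝ)| ≤ 13 / 10 * |(kh : ℝ)| from ⟨hK, hW, hs⟩)]
      · rw [if_neg hW]; exact (hI _).1

/-! ## §1 FIRST LEMMA — the escape lemma (real variable; transport with dilation + ℓ¹ source ⇒ everything escapes) -/

/-- **Escape lemma** (real-variable renewal inequality).  If `F_n(u) ≥ 0` vanishes below a positive floor `κ_n`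
(the box), and one step is a dilation by `g > 1` up to an ℓ¹ error, `√F_{n+1}(u) ≤ √F_n(u/g) + ε_n` (`u ∈ (0,1]`,
`Σ ε_n < ∞`), then `F_n(u) → 0` for every `u ∈ (0,1]`: iterate to `√F_n(u) ≤ √F_j(u g^{-(n-j)}) + Σ_{m ≥ j} ε_m`, the first
term vanishing as soon as `u g^{-(n-j)} ≤ κ_j`.  Dominated convergence for a transient renewal sequence; NO smallness of
`Σ ε_n` is used. [folklore] -/
def EscapeLemma : Prop :=
  ∀ (g : ℝ), 1 < g → ∀ (F : ℕ → ℝ → ℝ) (ε κ : ℕ → ℝ),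
    (∀ n u, 0 ≤ F n u) → (∀ n, 0 < κ n) → (∀ n u, u ≤ κ n → F n u = 0) → (∀ n, 0 ≤ ε n) → Summable ε →
    (∀ n : ℕ, ∀ u ∈ Set.Ioc (0 : ℝ) 1, Real.sqrt (F (n + 1) u) ≤ Real.sqrt (F n (u / g)) + ε n) →
    ∀ u ∈ Set.Ioc (0 : ℝ) 1, Tendsto (fun n => F n u) atTop (𝓝 0)

/-- **PROVED: the escape lemma holds** (elementary: iterate the renewal inequality down to the floor, then let the
starting phase go to infinity along the summable tail). -/
theorem escapeLemma : EscapeLemma := by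
  intro g hg F ε κ hF hκ hfloor hε hεs hstep u hu
  have hg0 : 0 < g := by linarith
  have hg1 : 1 ≤ g := hg.le
  -- iterate: `√F_{j+m}(v) ≤ √F_j(v/g^m) + Σ_{i<m} ε_{j+i}` for `v ∈ (0,1]`
  have iter : ∀ m j : ℕ, ∀ v ∈ Set.Ioc (0 : ℝ) 1,
      Real.sqrt (F (j + m) v) ≤ Real.sqrt (F j (v / g ^ m)) + ∑ i ∈ Finset.range m, ε (j + i) := by
    intro m
    induction m with
    | zero => intro j v hv; simp
    | succ m ih =>
      intro j v hv
      have hv' : v / g ∈ Set.Ioc (0 : ℝ) 1 := ⟨div_pos hv.1 hg0, (div_le_self hv.1.le hg1).trans hv.2⟩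
      have h1 := hstep (j + m) v hv
      have h2 := ih j (v / g) hv'
      have h3 : v / g / g ^ m = v / g ^ (m + 1) := by rw [div_div, pow_succ']
      calc Real.sqrt (F (j + (m + 1)) v) = Real.sqrt (F (j + m + 1) v) := rfl
        _ ≤ Real.sqrt (F (j + m) (v / g)) + ε (j + m) := h1
        _ ≤ (Real.sqrt (F j (v / g / g ^ m)) + ∑ i ∈ Finset.range m, ε (j + i)) + ε (j + m) := by
            linarith [h2]
        _ = Real.sqrt (F j (v / g ^ (m + 1))) + ∑ i ∈ Finset.range (m + 1), ε (j + i) := by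
            rw [h3, Finset.sum_range_succ, add_assoc]
  rw [Metric.tendsto_atTop]
  intro δ hδ
  -- the summable tail
  have htail : Tendsto (fun j => ∑' k, ε (k + j)) atTop (𝓝 0) := tendsto_sum_nat_add ε
  obtain ⟨j, hj⟩ := (Metric.tendsto_atTop.1 htail) (Real.sqrt δ / 2) (by positivity)
  have hj' : ∑' k, ε (k + j) < Real.sqrt δ / 2 := by
    have := hj j le_rfl
    rwa [Real.dist_eq, sub_zero, abs_of_nonneg (tsum_nonneg fun k => hε _)] at this
  -- the floor is reached after `M` further phases
  obtain ⟨M, hM⟩ : ∃ M : ℕ, u / κ j ≤ g ^ M :=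
    ((tendsto_pow_atTop_atTop_of_one_lt hg).eventually (eventually_ge_atTop (u / κ j))).exists
  refine ⟨j + M, fun n hn => ?_⟩
  obtain ⟨m, rfl⟩ : ∃ m, n = j + m := ⟨n - j, by omega⟩
  have hmM : M ≤ m := by omega
  have hκj := hκ j
  have hfl : F j (u / g ^ m) = 0 := by
    apply hfloor
    have hgm : g ^ M ≤ g ^ m := pow_le_pow_right₀ hg1 hmM
    have huk : u ≤ κ j * g ^ M := by
      have := mul_le_mul_of_nonneg_left hM hκj.le
      rwa [mul_div_cancel₀ _ hκj.ne'] at this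
    rw [div_le_iff₀ (pow_pos hg0 m)]
    calc u ≤ κ j * g ^ M := huk
      _ ≤ κ j * g ^ m := mul_le_mul_of_nonneg_left hgm hκj.le
  have hsum_le : ∑ i ∈ Finset.range m, ε (j + i) ≤ ∑' k, ε (k + j) := by
    have hs : Summable (fun k => ε (k + j)) := (summable_nat_add_iff j).2 hεs
    calc ∑ i ∈ Finset.range m, ε (j + i) = ∑ i ∈ Finset.range m, ε (i + j) := by simp only [add_comm]
      _ ≤ ∑' k, ε (k + j) := hs.sum_le_tsum (Finset.range m) (fun k _ => hε _)
  have key := iter m j u hu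
  rw [hfl, Real.sqrt_zero, zero_add] at key
  have hsq : Real.sqrt (F (j + m) u) < Real.sqrt δ / 2 := lt_of_le_of_lt (key.trans hsum_le) hj'
  have h0 : 0 ≤ Real.sqrt (F (j + m) u) := Real.sqrt_nonneg _
  rw [Real.dist_eq, sub_zero, abs_of_nonneg (hF _ _)]
  have hFsq : F (j + m) u = Real.sqrt (F (j + m) u) ^ 2 := (Real.sq_sqrt (hF _ _)).symm
  have hδsq : Real.sqrt δ ^ 2 = δ := Real.sq_sqrt hδ.le
  nlinarith [hsq, h0, Real.sqrt_nonneg δ]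

/-! ## §2 The renewal package for the cascade (conjectures; shape P, `c > 0` free, box parameter `θ`) -/

/-- **Lag renewal** (the controlling inequality), with a DILATION PARAMETER `g > 1` (any fixed
`g ∈ (1, (γ²−23/10)/(γ²−3)]`; the maximal value is the clean rate: a strong on-cone mode off the corner zones grows by
`≥ γ² − 23/10 = γ²−1−13/10`, `SawtoothCascade.sawtooth_cone_step` with `m = 13/10`, while the threshold grows by `γ² − 3`;
a smaller `g` absorbs the near-carrier sinc spread of the piecewise-linear grating).  Along the inviscid iterates of the
datum, the escaping population at relative lag `u` after phase `n+1` comes from relative lag `u/g` at phase `n` up to a FRESH source `ε_n‖datum‖` in amplitude — undo-sideband demotion of strong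
modes `O((N_n/(γ|k₀|))·window)`, corner-zone passage `≤ 2|Z_n| = 4.6·δ₀2^{-n}` of the energy, steep return, box leakage —
with `Σ ε_n < ∞` (geometric tails; early phases merely finite).  Amplitude form because the transported and the fresh parts
are not orthogonal. -/
def LagRenewal (P : CascadeParams) (c θ g : ℝ) : Prop :=
  ∃ ε : ℕ → ℝ, (∀ n, 0 ≤ ε n) ∧ Summable ε ∧
    ∀ (hδ₀ : 0 < P.δ₀) (hd : 0 < P.d) (a b : ℕ → UnitAddTorus (Fin 2) → ℝ),
    (∀ j, IsSmooth (a j)) → a 0 = datum →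
    (∀ j, b j = a j ∘ shearMap 0 1 (amp ⟨P.U j, P.U_periodic j, P.contDiff_U (P.δ_pos hδ₀ hd j)⟩ P.γ)) →
    (∀ j, a (j + 1) = b j ∘ shearMap 1 0 (amp ⟨P.U j, P.U_periodic j, P.contDiff_U (P.δ_pos hδ₀ hd j)⟩ P.γ)) →
    ∀ n : ℕ, ∀ u ∈ Set.Ioc (0 : ℝ) 1,
      Real.sqrt (coneBandEnergy P.γ (boxRadius P θ (n + 1)) (u * (c * (P.γ ^ 2 - 3) ^ (n + 1))) (a (n + 1))) ≤
        Real.sqrt (coneBandEnergy P.γ (boxRadius P θ n) (u / g * (c * (P.γ ^ 2 - 3) ^ n)) (a n)) +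
          ε n * Real.sqrt (Torus.scalarL2Sq datum)

/-- **Steep transient.**  The steep population above the box tends to zero: a steep parcel re-enters the cone within
`O(log)` phases (Möbius contraction of slopes, `sawtooth_cone_step`) unless it hugs the repelling direction, where its
frequency SHRINKS by `≈ γ^{-2}` per phase until it drops into the box; it is fed only by the fresh sources of `LagRenewal`. -/
def SteepTransient (P : CascadeParams) (θ : ℝ) : Prop :=
  ∀ (hδ₀ : 0 < P.δ₀) (hd : 0 < P.d) (a b : ℕ → UnitAddTorus (Fin 2) → ℝ),
    (∀ j, IsSmooth (a j)) → a 0 = datum →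
    (∀ j, b j = a j ∘ shearMap 0 1 (amp ⟨P.U j, P.U_periodic j, P.contDiff_U (P.δ_pos hδ₀ hd j)⟩ P.γ)) →
    (∀ j, a (j + 1) = b j ∘ shearMap 1 0 (amp ⟨P.U j, P.U_periodic j, P.contDiff_U (P.δ_pos hδ₀ hd j)⟩ P.γ)) →
    Tendsto (fun n => steepEnergy P.γ (boxRadius P θ n) (a n)) atTop (𝓝 0)

/-- **Box bound** — the ONLY number of the line that is compared with `‖datum‖² = ½`.  The frozen box holds at most the
fraction `ζ` of the energy at every late phase (only `ζ < 1` is ever used): it is fed by the phase-0 atom `|ĝ_{±1}(0)|² ≤ 4/(π²γ²) ≤ 1.7 %` (then sheared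
out while the grating is still strong) and by DEEP demotion (stationary points at the rounded corner tops, weight
`O(δ_n/(γ|k₁|))`, and sideband tails `O(N_n²/(γ²k₀²))`); expected `ζ ≤ 1/20` uniformly on `5 ≤ γ ≤ 8`, `δ₀ ≤ 1/4`
(numerics g0 kit j297560: energy at `|k₀| ≤ (γ²−3)ⁿ/64` is `0.4–2 %` for `n ≤ 4` at `(γ,δ₀) = (5,¼)`). -/
def BoxBound (P : CascadeParams) (θ ζ : ℝ) : Prop :=
  ∀ (hδ₀ : 0 < P.δ₀) (hd : 0 < P.d) (a b : ℕ → UnitAddTorus (Fin 2) → ℝ),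
    (∀ j, IsSmooth (a j)) → a 0 = datum →
    (∀ j, b j = a j ∘ shearMap 0 1 (amp ⟨P.U j, P.U_periodic j, P.contDiff_U (P.δ_pos hδ₀ hd j)⟩ P.γ)) →
    (∀ j, a (j + 1) = b j ∘ shearMap 1 0 (amp ⟨P.U j, P.U_periodic j, P.contDiff_U (P.δ_pos hδ₀ hd j)⟩ P.γ)) →
    ∃ n₁ : ℕ, ∀ n : ℕ, n₁ ≤ n → boxEnergy (boxRadius P θ n) (a n) ≤ ζ * Torus.scalarL2Sq datum

/-! ## §3 Transfer target and glue -/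

/-- **Escape target** = the hypothesis `hch` of `K1Ledger.From.k1Localised_of_thin_lowBand_offCone_frequently`, for EVERY
`c > 0` with ONE level `Q < ‖datum‖²`: infinitely many phases at which `LowBand_n(c) + HighOffCone_n(c) ≤ Q`. -/
def EscapeTarget (P : CascadeParams) : Prop :=
  ∃ Q : ℝ, Q < Torus.scalarL2Sq datum ∧ ∀ c : ℝ, 0 < c →
    ∀ (hδ₀ : 0 < P.δ₀) (hd : 0 < P.d) (a b : ℕ → UnitAddTorus (Fin 2) → ℝ),
    (∀ j, IsSmooth (a j)) → a 0 = datum →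
    (∀ j, b j = a j ∘ shearMap 0 1 (amp ⟨P.U j, P.U_periodic j, P.contDiff_U (P.δ_pos hδ₀ hd j)⟩ P.γ)) →
    (∀ j, a (j + 1) = b j ∘ shearMap 1 0 (amp ⟨P.U j, P.U_periodic j, P.contDiff_U (P.δ_pos hδ₀ hd j)⟩ P.γ)) →
    ∃ᶠ n : ℕ in atTop,
      ∑' k : Fin 2 → ℤ, (if |((k 0 : ℤ) : ℝ)| < (1 + 1 / 250) * (c * (P.γ ^ 2 - 3) ^ n) then (1 : ℝ) else 0) *
          ‖mFourierCoeff (fun x => (a n x : ℂ)) k‖ ^ 2 +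
        ∑' k : Fin 2 → ℤ, (if (1 + 1 / 250) * (c * (P.γ ^ 2 - 3) ^ n) ≤ |((k 0 : ℤ) : ℝ)| ∧
            13 / 10 * |((k 0 : ℤ) : ℝ)| < P.γ * |((k 1 : ℤ) : ℝ)| then (1 : ℝ) else 0) *
          ‖mFourierCoeff (fun x => (a n x : ℂ)) k‖ ^ 2 ≤ Q

/-- **Escape assembly** (logic + limits): escape lemma + renewal (dilation `g > 1`) for every `c` + steep transient + box bound `ζ < 1` ⇒ the
escape target with `Q = (1+ζ)/2·‖datum‖²` — apply `EscapeLemma` to `F_n(u) = coneBandEnergy` at `c' = (1+1/250)c`,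
`u = 1`, dominate the two channels by `channels_indicator_le`, and note that in fact ALL LARGE `n` qualify. -/
def EscapeAssembly : Prop :=
  ∀ (P : CascadeParams) (θ ζ g : ℝ), 5 ≤ P.γ → 0 < θ → ζ < 1 → 1 < g → EscapeLemma →
    (∀ c : ℝ, 0 < c → LagRenewal P c θ g) → SteepTransient P θ → BoxBound P θ ζ → EscapeTarget P

/-- **PROVED: the escape assembly holds** (logic, limits and Parseval: the two channels of the S-D target are dominated
termwise by box + escaping + steep, `channels_indicator_le`; the escaping population at `u = 1` tends to zero by the
escape lemma applied at `c' = (1+1/250)c`; the steep one by hypothesis; the box is eventually `≤ ζ‖datum‖²`). -/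
theorem escapeAssembly : EscapeAssembly := by
  intro P θ ζ g hγ hθ hζ hg1 hEL hR hS hB
  have hE : 0 < Torus.scalarL2Sq datum := by
    rw [Summit.AnomalousDissipation.AnomalousDissipation.Theorems.SawtoothPulseCascade.K1Start.scalarL2Sq_datum]; norm_num
  refine ⟨(1 + ζ) / 2 * Torus.scalarL2Sq datum, by nlinarith, ?_⟩
  intro c hc hδ₀ hd a b has h0 hb hab
  have hγ0 : 0 < P.γ := by linarith
  have hr3 : (3 : ℝ) < P.γ ^ 2 - 3 := by nlinarith
  have hr0 : 0 < P.γ ^ 2 - 3 := by linarith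
  have hc' : 0 < (1 + 1 / 250) * c := by positivity
  obtain ⟨ε, hε0, hεs, hren⟩ := hR ((1 + 1 / 250) * c) hc'
  have hren' := hren hδ₀ hd a b has h0 hb hab
  have hsteep := hS hδ₀ hd a b has h0 hb hab
  obtain ⟨n₁, hbox⟩ := hB hδ₀ hd a b has h0 hb hab
  -- the escaping population `F n u`
  set F : ℕ → ℝ → ℝ := fun n u =>
    coneBandEnergy P.γ (boxRadius P θ n) (u * ((1 + 1 / 250) * c * (P.γ ^ 2 - 3) ^ n)) (a n) with hFdef
  have hK0 : ∀ n, 0 ≤ boxRadius P θ n := fun n => by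
    unfold boxRadius; positivity
  have hF0 : ∀ n u, 0 ≤ F n u := fun n u =>
    tsum_nonneg fun k => mul_nonneg (by split_ifs <;> norm_num) (sq_nonneg _)
  -- the floor `κ n = max(K_n, 1)/(c' rⁿ)`: below it the band `K_n < |k₀| < u c' rⁿ` contains no integer
  have hfloor : ∀ n u, u ≤ max (boxRadius P θ n) 1 / ((1 + 1 / 250) * c * (P.γ ^ 2 - 3) ^ n) → F n u = 0 := by
    intro n u hu
    have hW : u * ((1 + 1 / 250) * c * (P.γ ^ 2 - 3) ^ n) ≤ max (boxRadius P θ n) 1 := by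
      have hpos : 0 < (1 + 1 / 250) * c * (P.γ ^ 2 - 3) ^ n := by positivity
      rwa [le_div_iff₀ hpos] at hu
    have hterm : ∀ k : Fin 2 → ℤ, (if boxRadius P θ n < |((k 0 : ℤ) : ℝ)| ∧
        |((k 0 : ℤ) : ℝ)| < u * ((1 + 1 / 250) * c * (P.γ ^ 2 - 3) ^ n) ∧
        P.γ * |((k 1 : ℤ) : ℝ)| ≤ 13 / 10 * |((k 0 : ℤ) : ℝ)| then (1 : ℝ) else 0) *
        ‖mFourierCoeff (fun x => (a n x : ℂ)) k‖ ^ 2 = 0 := by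
      intro k
      rw [ite_eq_right_iff.2, zero_mul]
      rintro ⟨h1, h2, -⟩
      exfalso
      have h3 : |((k 0 : ℤ) : ℝ)| < max (boxRadius P θ n) 1 := lt_of_lt_of_le h2 hW
      rcases lt_max_iff.1 h3 with h4 | h4
      · exact absurd h1 (not_lt.2 h4.le)
      · have h5 : |k 0| < 1 := by exact_mod_cast h4
        have h6 : k 0 = 0 := by have := abs_lt.1 h5; omega
        have h7 : |((k 0 : ℤ) : ℝ)| = 0 := by simp [h6]
        linarith [hK0 n]
    show (∑' k : Fin 2 → ℤ, _) = 0
    simp only [hterm, tsum_zero]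
  have hε' : Summable fun n => ε n * Real.sqrt (Torus.scalarL2Sq datum) := hεs.mul_right _
  have hlim : Tendsto (fun n => F n 1) atTop (𝓝 0) :=
    hEL _ hg1 F (fun n => ε n * Real.sqrt (Torus.scalarL2Sq datum))
      (fun n => max (boxRadius P θ n) 1 / ((1 + 1 / 250) * c * (P.γ ^ 2 - 3) ^ n)) hF0
      (fun n => by positivity) hfloor (fun n => mul_nonneg (hε0 n) (Real.sqrt_nonneg _)) hε'
      (fun n u hu => hren' n u hu) 1 ⟨one_pos, le_rfl⟩
  -- eventual smallness of the three populations
  have hroom : 0 < (1 - ζ) / 4 * Torus.scalarL2Sq datum := by nlinarith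
  have e1 : ∀ᶠ n : ℕ in atTop, F n 1 < (1 - ζ) / 4 * Torus.scalarL2Sq datum :=
    hlim.eventually (Iio_mem_nhds hroom)
  have e2 : ∀ᶠ n : ℕ in atTop, steepEnergy P.γ (boxRadius P θ n) (a n) < (1 - ζ) / 4 * Torus.scalarL2Sq datum :=
    hsteep.eventually (Iio_mem_nhds hroom)
  have e3 : ∀ᶠ n : ℕ in atTop, boxEnergy (boxRadius P θ n) (a n) ≤ ζ * Torus.scalarL2Sq datum :=
    (eventually_ge_atTop n₁).mono fun n hn => hbox n hn
  refine ((e1.and e2).and e3).frequently.mono fun n hn => ?_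
  obtain ⟨⟨h1, h2⟩, h3⟩ := hn
  -- termwise domination of the two channels by box + escaping + steep
  have hP := (Summit.AnomalousDissipation.AnomalousDissipation.Theorems.SawtoothPulseCascade.SpectralLeakage.hasSum_sq_norm_mFourierCoeff_scalarL2Sq
    (has n).continuous).summable
  have hsI : ∀ (p : (Fin 2 → ℤ) → Prop) [DecidablePred p],
      Summable fun k => (if p k then (1 : ℝ) else 0) * ‖mFourierCoeff (fun x => (a n x : ℂ)) k‖ ^ 2 := by
    intro p _
    refine Summable.of_nonneg_of_le (fun k => mul_nonneg (by split_ifs <;> norm_num) (sq_nonneg _)) (fun k => ?_) hP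
    split_ifs <;> simp
  have hW : (1 : ℝ) * ((1 + 1 / 250) * c * (P.γ ^ 2 - 3) ^ n) = (1 + 1 / 250) * (c * (P.γ ^ 2 - 3) ^ n) := by ring
  have hFn : F n 1 = coneBandEnergy P.γ (boxRadius P θ n) ((1 + 1 / 250) * (c * (P.γ ^ 2 - 3) ^ n)) (a n) := by
    simp only [hFdef, hW]
  rw [hFn] at h1
  have hA := hsI (fun k => |((k 0 : ℤ) : ℝ)| < (1 + 1 / 250) * (c * (P.γ ^ 2 - 3) ^ n))
  have hB' := hsI (fun k => (1 + 1 / 250) * (c * (P.γ ^ 2 - 3) ^ n) ≤ |((k 0 : ℤ) : ℝ)| ∧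
    13 / 10 * |((k 0 : ℤ) : ℝ)| < P.γ * |((k 1 : ℤ) : ℝ)|)
  have hC := hsI (fun k => |((k 0 : ℤ) : ℝ)| ≤ boxRadius P θ n)
  have hD := hsI (fun k => boxRadius P θ n < |((k 0 : ℤ) : ℝ)| ∧
    |((k 0 : ℤ) : ℝ)| < (1 + 1 / 250) * (c * (P.γ ^ 2 - 3) ^ n) ∧ P.γ * |((k 1 : ℤ) : ℝ)| ≤ 13 / 10 * |((k 0 : ℤ) : ℝ)|)
  have hE' := hsI (fun k => boxRadius P θ n < |((k 0 : ℤ) : ℝ)| ∧ 13 / 10 * |((k 0 : ℤ) : ℝ)| < P.γ * |((k 1 : ℤ) : ℝ)|)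
  have hdom : ∑' k : Fin 2 → ℤ, (if |((k 0 : ℤ) : ℝ)| < (1 + 1 / 250) * (c * (P.γ ^ 2 - 3) ^ n) then (1 : ℝ) else 0) *
          ‖mFourierCoeff (fun x => (a n x : ℂ)) k‖ ^ 2 +
        ∑' k : Fin 2 → ℤ, (if (1 + 1 / 250) * (c * (P.γ ^ 2 - 3) ^ n) ≤ |((k 0 : ℤ) : ℝ)| ∧
            13 / 10 * |((k 0 : ℤ) : ℝ)| < P.γ * |((k 1 : ℤ) : ℝ)| then (1 : ℝ) else 0) *
          ‖mFourierCoeff (fun x => (a n x : ℂ)) k‖ ^ 2 ≤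
      boxEnergy (boxRadius P θ n) (a n) +
        coneBandEnergy P.γ (boxRadius P θ n) ((1 + 1 / 250) * (c * (P.γ ^ 2 - 3) ^ n)) (a n) +
        steepEnergy P.γ (boxRadius P θ n) (a n) := by
    unfold boxEnergy coneBandEnergy steepEnergy
    rw [← hA.tsum_add hB', ← hC.tsum_add hD, ← (hC.add hD).tsum_add hE']
    refine Summable.tsum_le_tsum (fun k => ?_) (hA.add hB') ((hC.add hD).add hE')
    rw [← add_mul, ← add_mul, ← add_mul]
    exact mul_le_mul_of_nonneg_right (channels_indicator_le P.γ (boxRadius P θ n) _ (k 0) (k 1)) (sq_nonneg _)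
  linarith

/-- **PROVED glue: the escape target decides the shape-P crux conjunct.**  `EscapeTarget P ⇒ K1Localised P (γ² − 3)` for
`5 ≤ γ ≤ 8`, `0 < δ₀ ≤ 1/4`, `d = 2`, `N₀ = 1`, `ρN = 2` — the inviscid iterates exist and are smooth (recursion +
`IsSmooth.comp_shearMap`), and `K1Ledger.From.k1Localised_of_thin_lowBand_offCone_frequently` (`L_min = 1000`, `c = 1`)
closes. [cite: DEIJ2022, (1.2)–(1.3)] [cite: ElgindiLissMattingly2025, §1.2.2 and §3.1] -/
theorem k1Localised_of_escapeTarget (P : CascadeParams) (hγ : 5 ≤ P.γ) (hγ' : P.γ ≤ 8) (hδ₀ : 0 < P.δ₀)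
    (hδ₀' : P.δ₀ ≤ 1 / 4) (hd : P.d = 2) (hN₀ : P.N₀ = 1) (hρN : P.ρN = 2) (h : EscapeTarget P) :
    K1Localised P (P.γ ^ 2 - 3) := by
  have hdpos : 0 < P.d := by rw [hd]; norm_num
  -- the inviscid iterates of the datum
  let φ : ℕ → ShearProfile := fun j => amp ⟨P.U j, P.U_periodic j, P.contDiff_U (P.δ_pos hδ₀ hdpos j)⟩ P.γ
  let a : ℕ → UnitAddTorus (Fin 2) → ℝ := fun n =>
    Nat.rec (motive := fun _ => UnitAddTorus (Fin 2) → ℝ) datum (fun j aj => (aj ∘ shearMap 0 1 (φ j)) ∘ shearMap 1 0 (φ j)) n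
  let b : ℕ → UnitAddTorus (Fin 2) → ℝ := fun j => a j ∘ shearMap 0 1 (φ j)
  have h0 : a 0 = datum := rfl
  have hb : ∀ j, b j = a j ∘ shearMap 0 1 (φ j) := fun j => rfl
  have hab : ∀ j, a (j + 1) = b j ∘ shearMap 1 0 (φ j) := fun j => rfl
  have hdat : IsSmooth datum := by
    have hper : Function.Periodic (fun s : ℝ => Real.sin (2 * Real.pi * s)) 1 := fun s => by
      simp [mul_add, Real.sin_add_two_pi]
    have hl : Torus.lift datum = fun y : EuclideanSpace ℝ (Fin 2) => Real.sin (2 * Real.pi * y 0) := by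
      funext y
      exact Torus.lift_coordFun_apply hper 0 y
    unfold Torus.IsSmooth
    rw [hl]
    exact Real.contDiff_sin.comp (contDiff_const.mul (contDiff_euclidean.1 contDiff_id 0))
  have has : ∀ j, IsSmooth (a j) := by
    intro j
    induction j with
    | zero => exact hdat
    | succ j ih => exact (ih.comp_shearMap 0 1 (φ j)).comp_shearMap 1 0 (φ j)
  obtain ⟨Q, hQ, hc⟩ := h
  have hch := hc 1 one_pos hδ₀ hdpos a b has h0 hb hab
  exact k1Localised_of_thin_lowBand_offCone_frequently P hγ hγ' hδ₀ hδ₀' hd hN₀ hρN (Lm := 1000) le_rfl a b has h0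
    hb hab one_pos hQ (by simpa using hch)

/-- **PROVED: the whole line in one implication** (what a crux-plan skeleton would register as `K1LocalisedCascade_of`
for the shape-P conjunct): the THREE cascade statements of §2 — lag renewal for every `c > 0`, steep transient, box bound —
with some box parameter `θ > 0`, some `ζ < 1` and some dilation `g > 1` decide `K1Localised P (γ² − 3)` on the
shape-P box, `δ₀ = 1/4` included; the escape lemma and the assembly are theorems (`escapeLemma`, `escapeAssembly`). -/
theorem k1Localised_of_escape_package (P : CascadeParams) (hγ : 5 ≤ P.γ) (hγ' : P.γ ≤ 8) (hδ₀ : 0 < P.δ₀)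
    (hδ₀' : P.δ₀ ≤ 1 / 4) (hd : P.d = 2) (hN₀ : P.N₀ = 1) (hρN : P.ρN = 2) {θ ζ g : ℝ} (hθ : 0 < θ) (hζ : ζ < 1)
    (hg : 1 < g) (hR : ∀ c : ℝ, 0 < c → LagRenewal P c θ g) (hS : SteepTransient P θ) (hB : BoxBound P θ ζ) :
    K1Localised P (P.γ ^ 2 - 3) :=
  k1Localised_of_escapeTarget P hγ hγ' hδ₀ hδ₀' hd hN₀ hρN (escapeAssembly P θ ζ g hγ hθ hζ hg escapeLemma hR hS hB)

end Summit.AnomalousDissipation.AnomalousDissipation.Cruxes.K1LocalisedCascade.LagEscape
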